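import Summits.NavierStokesRegularity.NavierStokesRegularity.Theses.CertifiedBlowup
import Literature.Analysis.FluidPDE.TaoClassGlue
import Summits.NavierStokesRegularity.NavierStokesRegularity.Theorems.CertifiedBlowupCertifiedBlowupAxisymBlowupStubCompact
import Summits.NavierStokesRegularity.NavierStokesRegularity.Theorems.CertifiedBlowupCertifiedBlowupAxisymBlowupStubH1Step
import Summits.NavierStokesRegularity.NavierStokesRegularity.Theorems.CertifiedBlowupCertifiedBlowupAxisymBlowupStubH1Interp
import Summits.NavierStokesRegularity.NavierStokesRegularity.Theorems.CertifiedBlowupCertifiedBlowupAxisymBlowupStubStabilityOfStep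
import Summits.NavierStokesRegularity.NavierStokesRegularity.Theorems.CertifiedBlowupCertifiedBlowupAxisymBlowupStubMaximal
import Summits.NavierStokesRegularity.NavierStokesRegularity.Theorems.CertifiedBlowupCertifiedBlowupAxisymBlowupIffNotAxisymRegular

/-!
# Line `compact-amplification` — REGISTERED SKELETON for the crux `CertifiedBlowupAxisymBlowup`
(X5a_axi, stmt-NavierStokesRegularity-0727; shared by routes CertifiedBlowup / DimensionLadder /
SwirlThreshold), crux-strategist `cstrat-stmt-NavierStokesRegularity-0727-h1`, 2026-08-17.

TRANSFER (concentration–compactness, Tao 2013 = arXiv:1108.1165, Thm. 1.20 (vi) / Prop. 11.? (arXiv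
Prop. 85) "qualitative regularity ⇔ quantitative a-priori bound", run INSIDE the axisymmetric class and
inside a COMPACT data family so that no profile decomposition is needed):

  X5a_axi  ⇐  C⁺ := UNBOUNDED ENSTROPHY AMPLIFICATION over a uniformly smooth, uniformly decaying
              family of AXISYMMETRIC data, along Tao-class (smooth, `L^∞_t H^k_x`) solutions on
              sub-slabs of `[0, 1]`                                    (`stub_amplification`, OPEN)
           +  sequential compactness of the family in `H¹` with a limit in the family
                                                                        (`stub_compact`, Arzelà–Ascoli)
           +  continuous dependence on the datum in `H¹` for Tao's class, with uniqueness
                 (`stub_stability_of_step` ⇐ `stub_h1_step` one-step H¹ recovery [RRS Cor 6.9 +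
                  Thm 7.1] + `stub_h1_interp` ‖∇f‖² ≲ ‖f‖‖D²f‖ + the tree's L² stability,
                  by time-stepping; lead reshape 2026-08-17, was `stub_stability`)
           +  Leray–Hopf MAXIMAL DEVELOPMENT: no Tao-class solution on `[0, T]` ⇒ a maximal smooth
              solution with lifespan `T* ≤ T`, Leray–Hopf on `[0, T*]` from the datum
                                                                        (`stub_maximal`, Leray / Tao §10–11)

Composition `amplification_composition` / `CertifiedBlowupAxisymBlowup_of` (PROVED below, no `sorry`): take `M = n`; extract an
`H¹`-convergent subsequence of the data with limit `a` in the family; if `a` had a Tao-class solution on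
`[0, 1]`, stability would bound the enstrophy of every Tao-class solution from nearby data on sub-slabs,
contradicting amplification `> n`; so `a` has none, and maximal development yields the witness
`(ν, T*, U, P)` with `U 0 = a` axisymmetric and rapidly decaying.

C⁺ speaks ONLY of smooth solutions on closed slabs (no singular object, no maximality, no weak-solution
bookkeeping); every instance "amplification > M" is a finite-time property of ONE smooth solution, open
under perturbation of the datum, hence certifiable by validated numerics of REGULAR solutions and
attackable by explicit constructions — see the line card `Lines/compact-amplification.md`.

STATUS (lead prover-line-stmt-NavierStokesRegularity-0727-0, 2026-08-17, cycle 1): the five bookkeeping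
stubs are LANDED (Theorems/CertifiedBlowupCertifiedBlowupAxisymBlowupStub{Compact,H1Step,H1Interp,
StabilityOfStep(+Tools),Maximal}.lean, p148495 p149625 p150862 p152355 p152622 p153276) and plugged in
below; the only `sorry` left is `stub_amplification` = C⁺, a genuine open problem. Moreover BOTH
directions of the transfer are landed as Theorems:
`…Theorems.CertifiedBlowupAxisymBlowup.CompactAmplification.certifiedBlowupAxisymBlowup_of_amplification`
(C⁺ → crux, Theorems/CertifiedBlowupCertifiedBlowupAxisymBlowupOfAmplification.lean, p155327) and
`…amplification_of_certifiedBlowupAxisymBlowup` (crux → C⁺, Theorems/…AmplificationOf.lean, p155316, via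
…AmplificationOfKato.lean p155046 [Kato maximal time ≥ lifespan; Tao-class developments below the
lifespan; enstrophy blow-up at the lifespan] and …AmplificationOfRescale.lean p155068 [time rescaling of
Tao's class]). Hence C⁺ ⇔ CertifiedBlowupAxisymBlowup is a THEOREM of the tree: the line loses nothing
and the crux is closed modulo exactly C⁺.

STATUS (continuation lead prover-line-stmt-NavierStokesRegularity-0727-c1-0, 2026-08-17, cycle 2):
the 'modulo local well-posedness' proviso is gone too. Landed `--supports`: the datum-wise Clay
dichotomy `clayOrBlowup` (Theorems/…ClayOrBlowup.lean, p157064: every smooth divergence-free rapidly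
decaying datum has a global classical bounded-energy solution OR launches a maximal Leray–Hopf
classical solution of finite lifespan; Kato maximal time + `stub_maximal`) and
`certifiedBlowupAxisymBlowup_iff_not_axisymmetricSwirlRegularity` (Theorems/…IffNotAxisymRegular.lean,
p157473): CertifiedBlowupAxisymBlowup ↔ ¬AxisymmetricSwirlRegularity (ns.S25, the conjecture leaf =
wall item stmt-NavierStokesRegularity-11332 of route CertifiedBlowup), together with
C⁺ ↔ crux ↔ ¬AX (`amplification_iff_not_axisymmetricSwirlRegularity`) and the exclusivity of the
dichotomy (`clayOrBlowup_exclusive`, X5b). So the one open stub below, the crux, and the negation of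
the registered open conjecture ns.S25 are ONE statement in three costumes, kernel-checked
(`stub_amplification_iff_not_axisymmetricSwirlRegularity` at the end of this file): proving any of
them is proving finite-time blow-up for axisymmetric Navier–Stokes with swirl; proving ns.S25 refutes
the crux. Nothing short of that open problem remains in this line.

STATUS (continuation leads c2 / c3, 2026-08-17, cycles 3–4): the open stub is unchanged (it is
the open problem); the line's durable output is the kernel-checked NECESSARY STRUCTURE OF EVERY
WITNESS `(ν, T, u, p)`, landed `--supports stmt-NavierStokesRegularity-0727` as registered stubs in
`Theorems/CertifiedBlowupCertifiedBlowupAxisymBlowup*.lean` (namespace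
`…Theorems.CertifiedBlowupAxisymBlowup.CompactAmplification`), all unconditional (discharged tree
facts only, axioms ⊆ {propext, Classical.choice, Quot.sound}). c2: swirl persists to `T`, sup|Γ|
strictly decreasing, Type II, no axis bound (…SwirlPersists, p161874); off-axis points regular at
`T` (…OffAxisRegular, p162528); normal form — `ν`, `T` immaterial (…NormalForm, p163216); blow-up
set nonempty, compact, on the axis (…BlowupSet, p163083); swirl order parameter (…SwirlOrderParameter,
p163235); Lei–Zhang relative threshold (…LeiZhangThreshold, p163601); KNSS blow-up limit (…KNSSLimit,
p164157). c3 (14 stubs): Leray velocity rates `‖u(t)‖_∞ ≥ c√ν/√(T−t)`, `L^r` rates (…LerayRates,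
p167427); Seregin `‖u(t)‖₃ → ∞`, ESS (…L3Blowup, p167540); Beale–Kato–Majda `∫₀ᵀ‖ω‖_∞ = ∞`
(…BKM, p167404); Constantin–Fefferman incoherence of the vorticity direction (…VorticityDirection,
p167430); CKN at the first singular time — the blow-up set is `ℋ¹`-null (…BlowupSetHausdorff,
p168059); swirl Reynolds numbers of witnesses are `ν`-independent (…SwirlNumber, p167604) and form a
set that is nonempty iff the crux, positive, with no least element (…SwirlNumberStructure, p168436);
no `BMO⁻¹` stream function up to `T`, Lei–Zhang 2011 (…NoBMOStream, p167572); Leray enstrophy rate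
`∫|∇u(t)|² ≥ cν^{3/2}/√(T−t)` (…EnstrophyRate, p168535) and lifespan bounds `T ≥ cν³/(∫|∇u₀|²)²`,
`T ≥ cν/‖u₀‖²_∞` (…LifespanBound, p169319); Gallagher–Koch–Planchon critical Besov blow-up
(…BesovBlowup, p168455); no extinction at `T` by backward uniqueness (…NoExtinction, p168714); the
crux in the WEAK formulation — ⇔ some axisymmetric Schwartz datum has a global Leray–Hopf weak
solution with a CKN-singular point (…WeakFormulation, p169136); all spatial derivatives bounded near
regular top points (…TopHigherRegularity, p169273).

STATUS (continuation lead c4, 2026-08-17, cycle 5): the open stub is unchanged (the open problem);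
9 further registered stubs about an arbitrary WITNESS landed `--supports` (all unconditional, std
axioms): no backward DISCRETELY self-similar witness about an axis point for any factor, no
axis-centred Leray ansatz with ANY profile — from the strict decrease of sup|Γ| alone (…NoDSS,
p172521); no Leray self-similar witness about any centre, NRS 1996 (…NoSelfSimilar, p172487);
Leray's eventual regularity `ν⁵T ≤ C(∫|u₀|²)²` and the product floor `cν⁴ ≤ (∫|u₀|²)(∫|∇u₀|²)`
(…LifespanCap, p172553); Kato's floor `εν < ‖u₀‖_{L³}` (…L3Floor, p172467); the Rusin–Šverák
threshold `ρ_max(ν) ≤ ‖u₀‖_{Ḣ^{1/2}}` (…RusinSverakThreshold, p172539); the Seregin–Šverák 2002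
pressure alternative (…PressureAlternative, p172420); ESS Thm 1.4 localised — `L^∞_t L³_x = ∞` in every
parabolic cylinder at every blow-up point (…LocalL3Blowup, p172664); the Fujita–Kato norm `‖u(t)‖_{Ḣ^{1/2}} → ∞` as `t ↑ T`
(…HomSobolevBlowup, p172839); the whole Ladyzhenskaya–Prodi–Serrin battery fails, `u ∉ L^q_t L^r_x(0,T)`
for `3 < r ≤ ∞`, `2/q + 3/r ≤ 1` (…LPSFamily, p172918); far-field regularity persists up to `T` — a
uniform bound on `[0,T) × {|x| ≥ R}` (…FarField, p172947). See `Cruxes/…/CYCLE-REPORT-c5.md`.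
-/

set_option linter.dupNamespace false

noncomputable section

open MeasureTheory Set Function Filter
open scoped ENNReal NNReal ContDiff Topology

namespace Summit.NavierStokesRegularity.NavierStokesRegularity.Cruxes.CertifiedBlowupAxisymBlowup.CompactAmplification

open Literature.Analysis.FluidPDE
open Summit.NavierStokesRegularity.NavierStokesRegularity.Theses.CertifiedBlowup

local notation "ℝ³" => EuclideanSpace ℝ (Fin 3)

/-- **C⁺ — unbounded enstrophy amplification in a compact axisymmetric data family (the transferred
crux; OPEN, the load-bearing stub).** For some viscosity `ν > 0` and some table of smoothness/decay
constants `C k K` there are, for every level `M`, a time `T ∈ (0, 1]`, an axisymmetric, divergence-free,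
smooth datum `u₀` obeying `(1 + |x|)^K ‖D^k u₀(x)‖ ≤ C k K` for all `k, K, x`, and a Tao-class solution
`(u, p)` on `[0, T] × ℝ³` from `u₀` whose enstrophy `∫ ‖∇u(t)‖²` exceeds `M` at some `t ∈ [0, T]`.
(Failure of the a-priori `H¹` bound of Tao 2013, Conj. 1.16, restricted to one compact family of
axisymmetric Schwartz data; equivalent to the crux given the three lemmas below and its converse.) -/
theorem stub_amplification :
    ∃ ν : ℝ, 0 < ν ∧ ∃ C : ℕ → ℕ → ℝ, ∀ M : ℝ, ∃ T : ℝ, 0 < T ∧ T ≤ 1 ∧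
      ∃ (u₀ : ℝ³ → ℝ³) (u : ℝ → ℝ³ → ℝ³) (p : ℝ → ℝ³ → ℝ),
        ContDiff ℝ ∞ u₀ ∧ VectorCalculus.IsDivFree u₀ ∧ IsAxisymmetric u₀ ∧
        (∀ (k K : ℕ) (x : ℝ³), (1 + ‖x‖) ^ K * ‖iteratedFDeriv ℝ k u₀ x‖ ≤ C k K) ∧
        IsTaoSolutionOn T ν u₀ u p ∧
        ∃ t ∈ Set.Icc 0 T, ENNReal.ofReal M < ∫⁻ x, ‖fderiv ℝ (u t) x‖ₑ ^ 2 := by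
  sorry

/-- **Sequential compactness of the uniformly smooth, uniformly decaying axisymmetric family**
(Arzelà–Ascoli on balls + uniform tails; the limit keeps the constants, smoothness, incompressibility
and axisymmetry, and the convergence holds in `H¹`). -/
theorem stub_compact :
    ∀ (C : ℕ → ℕ → ℝ) (a : ℕ → ℝ³ → ℝ³),
      (∀ n, ContDiff ℝ ∞ (a n) ∧ VectorCalculus.IsDivFree (a n) ∧ IsAxisymmetric (a n) ∧
        ∀ (k K : ℕ) (x : ℝ³), (1 + ‖x‖) ^ K * ‖iteratedFDeriv ℝ k (a n) x‖ ≤ C k K) →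
      ∃ (φ : ℕ → ℕ) (w : ℝ³ → ℝ³), StrictMono φ ∧ ContDiff ℝ ∞ w ∧ VectorCalculus.IsDivFree w ∧
        IsAxisymmetric w ∧
        (∀ (k K : ℕ) (x : ℝ³), (1 + ‖x‖) ^ K * ‖iteratedFDeriv ℝ k w x‖ ≤ C k K) ∧
        ∀ ε : ℝ, 0 < ε → ∃ N : ℕ, ∀ n, N ≤ n →
          (∫⁻ x, ‖a (φ n) x - w x‖ₑ ^ 2) + (∫⁻ x, ‖fderiv ℝ (a (φ n)) x - fderiv ℝ w x‖ₑ ^ 2) ≤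
            ENNReal.ofReal ε :=
  -- LANDED (Theorems/CertifiedBlowupCertifiedBlowupAxisymBlowupStub…): the registered stub, proved
  Summit.NavierStokesRegularity.NavierStokesRegularity.Theorems.CertifiedBlowupAxisymBlowup.CompactAmplification.stub_compact

/-- **One-step `H¹` recovery in Tao's class** (the quantitative local `H¹` theory, packaged:
Robinson–Rodrigo–Sadowski 2016, Cor. 6.9 + Thm. 7.1/7.3; Tao 2013, Thm. 5.4 (ii) + Lemma 5.5): for
`ν > 0` and a data bound `A ≥ 0` there are a step length `σ > 0`, an enstrophy bound `S` and an
`H²` bound `H` such that every Tao-class solution on a slab `[0, T]`, `0 < T ≤ σ`, from a datum with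
`‖w₀‖²_{L²} + ∫|∇w₀|² ≤ A` has enstrophy `≤ S` on `[0, T]`, and, if `T = σ`, satisfies
`∫ ‖D²w(σ)‖² ≤ H` (enstrophy a priori bound with lifespan, `leray_enstrophy_apriori_holds`, plus
quantitative smoothing at positive time, `tao2011_quantitative_regularity_holds`, plus the energy
inequality). -/
theorem stub_h1_step :
    ∀ ν : ℝ, 0 < ν → ∀ A : ℝ, 0 ≤ A → ∃ σ : ℝ, 0 < σ ∧ ∃ S H : ℝ,
      ∀ (T : ℝ) (w₀ : ℝ³ → ℝ³) (w : ℝ → ℝ³ → ℝ³) (q : ℝ → ℝ³ → ℝ), 0 < T → T ≤ σ →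
        IsTaoSolutionOn T ν w₀ w q →
        (∫⁻ x, ‖w₀ x‖ₑ ^ 2) + (∫⁻ x, ENNReal.ofReal (frobeniusNormSq (fderiv ℝ w₀ x))) ≤
          ENNReal.ofReal A →
        (∀ t ∈ Set.Icc 0 T,
            (∫⁻ x, ENNReal.ofReal (frobeniusNormSq (fderiv ℝ (w t) x))) ≤ ENNReal.ofReal S) ∧
          (T = σ → ∫⁻ x, ‖iteratedFDeriv ℝ 2 (w T) x‖ₑ ^ 2 ≤ ENNReal.ofReal H) :=
  -- LANDED (Theorems/CertifiedBlowupCertifiedBlowupAxisymBlowupStub…): the registered stub, proved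
  Summit.NavierStokesRegularity.NavierStokesRegularity.Theorems.CertifiedBlowupAxisymBlowup.CompactAmplification.stub_h1_step

/-- **Interpolation `‖∇f‖²_{L²} ≲ ‖f‖_{L²} ‖D²f‖_{L²}` on `ℝ³`** (Green's identity
`∫ Σᵢ⟪∂ᵢf, ∂ᵢf⟫ = −∫⟪Δf, f⟫`, Cauchy–Schwarz, `‖Δf‖ ≤ 3‖D²f‖`), stated in `[0, ∞]` and squared:
there is an absolute `K` with `(∫|∇f|²)² ≤ K (∫‖f‖²)(∫‖D²f‖²)` for every `C²` field with
`f, Df, D²f ∈ L²`. -/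
theorem stub_h1_interp :
    ∃ K : ℝ, 0 ≤ K ∧ ∀ f : ℝ³ → ℝ³, ContDiff ℝ 2 f → (∫⁻ x, ‖f x‖ₑ ^ 2) < ⊤ →
      (∫⁻ x, ‖iteratedFDeriv ℝ 1 f x‖ₑ ^ 2) < ⊤ → (∫⁻ x, ‖iteratedFDeriv ℝ 2 f x‖ₑ ^ 2) < ⊤ →
      (∫⁻ x, ENNReal.ofReal (frobeniusNormSq (fderiv ℝ f x))) ^ 2 ≤
        ENNReal.ofReal K * (∫⁻ x, ‖f x‖ₑ ^ 2) * (∫⁻ x, ‖iteratedFDeriv ℝ 2 f x‖ₑ ^ 2) :=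
  -- LANDED (Theorems/CertifiedBlowupCertifiedBlowupAxisymBlowupStub…): the registered stub, proved
  Summit.NavierStokesRegularity.NavierStokesRegularity.Theorems.CertifiedBlowupAxisymBlowup.CompactAmplification.stub_h1_interp

/-- **Continuous dependence on the datum in `H¹` for Tao's smooth class, from the one-step
recovery and the interpolation** (Tao 2013, Thm. 5.4 (iii)+(v); Robinson–Rodrigo–Sadowski 2016,
Thms. 6.8–6.10, 8.19): around a Tao-class solution `u` on `[0, T]` there are `δ > 0` and `B` such that
every Tao-class solution `v`, on any sub-slab `[0, T'] ⊆ [0, T]`, from a smooth divergence-free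
rapidly decaying datum `δ`-close in `H¹`, has enstrophy `≤ B` throughout. Time-stepping: with
`A = 4 sup_t ‖u(t)‖²_{H¹} + 8` and `σ, S, H` from the step, induct over the restart times `iσ ≤ T'`:
the `H¹` data bound `A` at `iσ` gives enstrophy `≤ S` on `[iσ, (i+1)σ] ∩ [0, T']` and `D²v((i+1)σ)`
bounded by `H`; the tree's `L²` stability (`exists_l2_stability`, RRS Thm. 6.10) keeps
`‖v − u‖_{L²}` of size `δ` on `[0, T']`, so the interpolation makes `‖∇(v − u)((i+1)σ)‖_{L²}`
small for `δ` small, recovering the data bound `A` at `(i+1)σ`. -/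
theorem stub_stability_of_step :
    (∀ ν : ℝ, 0 < ν → ∀ A : ℝ, 0 ≤ A → ∃ σ : ℝ, 0 < σ ∧ ∃ S H : ℝ,
      ∀ (T : ℝ) (w₀ : ℝ³ → ℝ³) (w : ℝ → ℝ³ → ℝ³) (q : ℝ → ℝ³ → ℝ), 0 < T → T ≤ σ →
        IsTaoSolutionOn T ν w₀ w q →
        (∫⁻ x, ‖w₀ x‖ₑ ^ 2) + (∫⁻ x, ENNReal.ofReal (frobeniusNormSq (fderiv ℝ w₀ x))) ≤
          ENNReal.ofReal A →
        (∀ t ∈ Set.Icc 0 T,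
            (∫⁻ x, ENNReal.ofReal (frobeniusNormSq (fderiv ℝ (w t) x))) ≤ ENNReal.ofReal S) ∧
          (T = σ → ∫⁻ x, ‖iteratedFDeriv ℝ 2 (w T) x‖ₑ ^ 2 ≤ ENNReal.ofReal H)) →
    (∃ K : ℝ, 0 ≤ K ∧ ∀ f : ℝ³ → ℝ³, ContDiff ℝ 2 f → (∫⁻ x, ‖f x‖ₑ ^ 2) < ⊤ →
      (∫⁻ x, ‖iteratedFDeriv ℝ 1 f x‖ₑ ^ 2) < ⊤ → (∫⁻ x, ‖iteratedFDeriv ℝ 2 f x‖ₑ ^ 2) < ⊤ →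
      (∫⁻ x, ENNReal.ofReal (frobeniusNormSq (fderiv ℝ f x))) ^ 2 ≤
        ENNReal.ofReal K * (∫⁻ x, ‖f x‖ₑ ^ 2) * (∫⁻ x, ‖iteratedFDeriv ℝ 2 f x‖ₑ ^ 2)) →
    ∀ ν : ℝ, 0 < ν → ∀ T : ℝ, 0 < T →
      ∀ (u₀ : ℝ³ → ℝ³) (u : ℝ → ℝ³ → ℝ³) (p : ℝ → ℝ³ → ℝ), IsTaoSolutionOn T ν u₀ u p →
        ∃ δ : ℝ, 0 < δ ∧ ∃ B : ℝ, ∀ (v₀ : ℝ³ → ℝ³), ContDiff ℝ ∞ v₀ → VectorCalculus.IsDivFree v₀ →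
          HasRapidSpatialDecay v₀ →
          (∫⁻ x, ‖v₀ x - u₀ x‖ₑ ^ 2) + (∫⁻ x, ‖fderiv ℝ v₀ x - fderiv ℝ u₀ x‖ₑ ^ 2) ≤
            ENNReal.ofReal δ →
          ∀ (T' : ℝ) (v : ℝ → ℝ³ → ℝ³) (q : ℝ → ℝ³ → ℝ), 0 < T' → T' ≤ T →
            IsTaoSolutionOn T' ν v₀ v q →
            ∀ t ∈ Set.Icc 0 T', (∫⁻ x, ‖fderiv ℝ (v t) x‖ₑ ^ 2) ≤ ENNReal.ofReal B :=
  -- LANDED (Theorems/CertifiedBlowupCertifiedBlowupAxisymBlowupStub…): the registered stub, proved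
  Summit.NavierStokesRegularity.NavierStokesRegularity.Theorems.CertifiedBlowupAxisymBlowup.CompactAmplification.stub_stability_of_step

/-- **Leray–Hopf maximal development** (Leray 1934 §31–34; Tao 2013 Thm 5.4, Thm 10.1 / Rem 10.6,
Cor 11.1; Beale–Kato–Majda): if a smooth divergence-free rapidly decaying datum admits NO Tao-class
solution on `[0, T]`, then it launches a maximal smooth solution of finite lifespan `T* ≤ T` which is
Leray–Hopf on `[0, T*]` from the datum (restart at the supremum of Tao-solvable times; `H¹` blow-up;
exterior enstrophy localisation confines the vorticity blow-up to a ball, which forbids any classical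
extension; Leray graft at `T*`). -/
theorem stub_maximal :
    ∀ ν : ℝ, 0 < ν → ∀ T : ℝ, 0 < T → ∀ (u₀ : ℝ³ → ℝ³), ContDiff ℝ ∞ u₀ →
      VectorCalculus.IsDivFree u₀ → HasRapidSpatialDecay u₀ →
      (¬ ∃ (u : ℝ → ℝ³ → ℝ³) (p : ℝ → ℝ³ → ℝ), IsTaoSolutionOn T ν u₀ u p) →
      ∃ Tstar : ℝ, 0 < Tstar ∧ Tstar ≤ T ∧ ∃ (u : ℝ → ℝ³ → ℝ³) (p : ℝ → ℝ³ → ℝ),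
        u 0 = u₀ ∧ IsMaximalSmoothSolution ν 0 u p Tstar ∧ IsLerayHopfOn Tstar ν 0 u₀ u :=
  -- LANDED (Theorems/CertifiedBlowupCertifiedBlowupAxisymBlowupStub…): the registered stub, proved
  Summit.NavierStokesRegularity.NavierStokesRegularity.Theorems.CertifiedBlowupAxisymBlowup.CompactAmplification.stub_maximal

/-- **Composition (PROVED): the four stubs give the crux `CertifiedBlowupAxisymBlowup` BY NAME.**
Amplification levels `M = n`; compactness extracts an `H¹`-convergent subsequence of the data with a
limit `a` in the family; were `a` Tao-solvable on `[0, 1]`, stability would cap the enstrophy of the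
amplifying solutions from nearby data (they live on sub-slabs `[0, T_{φ n}] ⊆ [0, 1]`), contradicting
amplification `> φ n ≥ n`; hence no Tao-class solution from `a` on `[0, 1]`, and maximal development
gives the maximal Leray–Hopf solution from the axisymmetric rapidly decaying datum `a`. -/
theorem amplification_composition
    (hA : ∃ ν : ℝ, 0 < ν ∧ ∃ C : ℕ → ℕ → ℝ, ∀ M : ℝ, ∃ T : ℝ, 0 < T ∧ T ≤ 1 ∧
      ∃ (u₀ : ℝ³ → ℝ³) (u : ℝ → ℝ³ → ℝ³) (p : ℝ → ℝ³ → ℝ),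
        ContDiff ℝ ∞ u₀ ∧ VectorCalculus.IsDivFree u₀ ∧ IsAxisymmetric u₀ ∧
        (∀ (k K : ℕ) (x : ℝ³), (1 + ‖x‖) ^ K * ‖iteratedFDeriv ℝ k u₀ x‖ ≤ C k K) ∧
        IsTaoSolutionOn T ν u₀ u p ∧
        ∃ t ∈ Set.Icc 0 T, ENNReal.ofReal M < ∫⁻ x, ‖fderiv ℝ (u t) x‖ₑ ^ 2)
    (hK : ∀ (C : ℕ → ℕ → ℝ) (a : ℕ → ℝ³ → ℝ³),
      (∀ n, ContDiff ℝ ∞ (a n) ∧ VectorCalculus.IsDivFree (a n) ∧ IsAxisymmetric (a n) ∧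
        ∀ (k K : ℕ) (x : ℝ³), (1 + ‖x‖) ^ K * ‖iteratedFDeriv ℝ k (a n) x‖ ≤ C k K) →
      ∃ (φ : ℕ → ℕ) (w : ℝ³ → ℝ³), StrictMono φ ∧ ContDiff ℝ ∞ w ∧ VectorCalculus.IsDivFree w ∧
        IsAxisymmetric w ∧
        (∀ (k K : ℕ) (x : ℝ³), (1 + ‖x‖) ^ K * ‖iteratedFDeriv ℝ k w x‖ ≤ C k K) ∧
        ∀ ε : ℝ, 0 < ε → ∃ N : ℕ, ∀ n, N ≤ n →
          (∫⁻ x, ‖a (φ n) x - w x‖ₑ ^ 2) + (∫⁻ x, ‖fderiv ℝ (a (φ n)) x - fderiv ℝ w x‖ₑ ^ 2) ≤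
            ENNReal.ofReal ε)
    (hS : ∀ ν : ℝ, 0 < ν → ∀ T : ℝ, 0 < T →
      ∀ (u₀ : ℝ³ → ℝ³) (u : ℝ → ℝ³ → ℝ³) (p : ℝ → ℝ³ → ℝ), IsTaoSolutionOn T ν u₀ u p →
        ∃ δ : ℝ, 0 < δ ∧ ∃ B : ℝ, ∀ (v₀ : ℝ³ → ℝ³), ContDiff ℝ ∞ v₀ → VectorCalculus.IsDivFree v₀ →
          HasRapidSpatialDecay v₀ →
          (∫⁻ x, ‖v₀ x - u₀ x‖ₑ ^ 2) + (∫⁻ x, ‖fderiv ℝ v₀ x - fderiv ℝ u₀ x‖ₑ ^ 2) ≤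
            ENNReal.ofReal δ →
          ∀ (T' : ℝ) (v : ℝ → ℝ³ → ℝ³) (q : ℝ → ℝ³ → ℝ), 0 < T' → T' ≤ T →
            IsTaoSolutionOn T' ν v₀ v q →
            ∀ t ∈ Set.Icc 0 T', (∫⁻ x, ‖fderiv ℝ (v t) x‖ₑ ^ 2) ≤ ENNReal.ofReal B)
    (hM : ∀ ν : ℝ, 0 < ν → ∀ T : ℝ, 0 < T → ∀ (u₀ : ℝ³ → ℝ³), ContDiff ℝ ∞ u₀ →
      VectorCalculus.IsDivFree u₀ → HasRapidSpatialDecay u₀ →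
      (¬ ∃ (u : ℝ → ℝ³ → ℝ³) (p : ℝ → ℝ³ → ℝ), IsTaoSolutionOn T ν u₀ u p) →
      ∃ Tstar : ℝ, 0 < Tstar ∧ Tstar ≤ T ∧ ∃ (u : ℝ → ℝ³ → ℝ³) (p : ℝ → ℝ³ → ℝ),
        u 0 = u₀ ∧ IsMaximalSmoothSolution ν 0 u p Tstar ∧ IsLerayHopfOn Tstar ν 0 u₀ u) :
    -- the crux `CertifiedBlowupAxisymBlowup`, written out (definitionally equal; the by-name conclusion
    -- is `CertifiedBlowupAxisymBlowup_of` below, whose only inputs are the four registered stubs)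
    ∃ ν : ℝ, 0 < ν ∧ ∃ T : ℝ, 0 < T ∧ ∃ (u : ℝ → ℝ³ → ℝ³) (p : ℝ → ℝ³ → ℝ),
      IsMaximalSmoothSolution ν 0 u p T ∧ IsLerayHopfOn T ν 0 (u 0) u ∧
      HasRapidSpatialDecay (u 0) ∧ IsAxisymmetric (u 0) := by
  classical
  obtain ⟨ν, hν, C, hamp⟩ := hA
  choose T hT0 hT1 u₀ u p hsm hdiv hax hdecay htao t ht hbig using fun n : ℕ => hamp (n : ℝ)
  obtain ⟨φ, a, hφ, hsm_a, hdiv_a, hax_a, hdec_a, hconv⟩ :=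
    hK C u₀ fun n => ⟨hsm n, hdiv n, hax n, hdecay n⟩
  have hdecA : HasRapidSpatialDecay a := fun k K => ⟨C k K, fun x => hdec_a k K x⟩
  -- no Tao-class solution from the limit datum on `[0, 1]`
  have hno : ¬ ∃ (v : ℝ → ℝ³ → ℝ³) (q : ℝ → ℝ³ → ℝ), IsTaoSolutionOn 1 ν a v q := by
    rintro ⟨v, q, hv⟩
    obtain ⟨δ, hδ, B, hstab⟩ := hS ν hν 1 one_pos a v q hv
    obtain ⟨N, hN⟩ := hconv δ hδ
    set n : ℕ := max N ⌈B⌉₊ with hn_def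
    have hnN : N ≤ n := le_max_left _ _
    have hBn : B ≤ (n : ℝ) :=
      (Nat.le_ceil B).trans (by exact_mod_cast le_max_right N ⌈B⌉₊)
    have hnφ : (n : ℝ) ≤ ((φ n : ℕ) : ℝ) := by exact_mod_cast hφ.id_le n
    have hdecφ : HasRapidSpatialDecay (u₀ (φ n)) :=
      fun k K => ⟨C k K, fun x => hdecay (φ n) k K x⟩
    have hbd := hstab (u₀ (φ n)) (hsm _) (hdiv _) hdecφ (hN n hnN) (T (φ n)) (u (φ n)) (p (φ n))
      (hT0 _) (hT1 _) (htao _) (t (φ n)) (ht _)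
    have hlt : ENNReal.ofReal (((φ n : ℕ) : ℝ)) < ENNReal.ofReal B := lt_of_lt_of_le (hbig _) hbd
    have hlt' : ((φ n : ℕ) : ℝ) < B :=
      (ENNReal.ofReal_lt_ofReal_iff_of_nonneg (Nat.cast_nonneg _)).1 hlt
    linarith
  obtain ⟨Ts, hTs0, -, U, P, hU0, hmax, hLH⟩ := hM ν hν 1 one_pos a hsm_a hdiv_a hdecA hno
  refine ⟨ν, hν, Ts, hTs0, U, P, hmax, ?_, ?_, ?_⟩
  · rw [hU0]; exact hLH
  · rw [hU0]; exact hdecA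
  · rw [hU0]; exact hax_a

/-- **The line concludes the crux BY NAME from the six registered stubs** (kernel-checked composition
`amplification_composition`; the stability input is `stub_stability_of_step stub_h1_step stub_h1_interp`;
no `sorry` outside the stubs). -/
theorem CertifiedBlowupAxisymBlowup_of : CertifiedBlowupAxisymBlowup :=
  amplification_composition stub_amplification stub_compact
    (stub_stability_of_step stub_h1_step stub_h1_interp) stub_maximal

/-- **The open stub is exactly the negation of ns.S25** (landed theorem
`amplification_iff_not_axisymmetricSwirlRegularity`, p157473): `stub_amplification`'s statement C⁺
holds iff the axisymmetric-with-swirl global regularity conjecture `AxisymmetricSwirlRegularity`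
(wall item stmt-NavierStokesRegularity-11332) fails. Recorded here so that the registered skeleton
displays what its one `sorry` is. -/
theorem stub_amplification_iff_not_axisymmetricSwirlRegularity :
    (∃ ν : ℝ, 0 < ν ∧ ∃ C : ℕ → ℕ → ℝ, ∀ M : ℝ, ∃ T : ℝ, 0 < T ∧ T ≤ 1 ∧
      ∃ (u₀ : ℝ³ → ℝ³) (u : ℝ → ℝ³ → ℝ³) (p : ℝ → ℝ³ → ℝ),
        ContDiff ℝ ∞ u₀ ∧ VectorCalculus.IsDivFree u₀ ∧ IsAxisymmetric u₀ ∧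
        (∀ (k K : ℕ) (x : ℝ³), (1 + ‖x‖) ^ K * ‖iteratedFDeriv ℝ k u₀ x‖ ≤ C k K) ∧
        IsTaoSolutionOn T ν u₀ u p ∧
        ∃ t ∈ Set.Icc 0 T, ENNReal.ofReal M < ∫⁻ x, ‖fderiv ℝ (u t) x‖ₑ ^ 2) ↔
    ¬ Literature.Analysis.FluidPDE.AxisymmetricSwirlRegularity :=
  Summit.NavierStokesRegularity.NavierStokesRegularity.Theorems.CertifiedBlowupAxisymBlowup.CompactAmplification.amplification_iff_not_axisymmetricSwirlRegularity

/-- **The crux is exactly the negation of ns.S25** (landed theorem, p157473). -/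
theorem certifiedBlowupAxisymBlowup_iff_not_axisymmetricSwirlRegularity :
    CertifiedBlowupAxisymBlowup ↔ ¬ Literature.Analysis.FluidPDE.AxisymmetricSwirlRegularity :=
  Summit.NavierStokesRegularity.NavierStokesRegularity.Theorems.CertifiedBlowupAxisymBlowup.CompactAmplification.certifiedBlowupAxisymBlowup_iff_not_axisymmetricSwirlRegularity

end Summit.NavierStokesRegularity.NavierStokesRegularity.Cruxes.CertifiedBlowupAxisymBlowup.CompactAmplification

end
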